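import Summits.QuantumFields.BalabanUV.Beta.SpineRecursiveT2AllFinal
import Summits.QuantumFields.BalabanUV.Beta.GAN24.CombQuarticTableLawTwinsA
import Summits.QuantumFields.BalabanUV.Beta.SpineRecursiveT2AllAntiTwin

-- `BalabanUV.Beta.GAN24.CombQuarticTableLawTwinsB`: W-an2-1 twin chain, links CombQuarticTableLawFinal, CombQuarticTableLawAntiTwin (one module per ≤ 400-line group; each link keeps its own module docstring, section and namespace).

/-!
# `BalabanUV.Beta.GAN24.CombQuarticTableLawFinal` — binder row G-an2-4 ∕ (CONV-C), W-slot, row (C) at levels ≥ 1, WANTED W-an2-1, THIRD TWIN OF an2's END CHAIN: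
# **THE QUARTIC TABLE LAW ⟸ THE THREE LETTERS, THEIR RESIDUAL CLASSES, THE SECOND-ORDER LOCK AND THE TABLE DATA — WITH THE REMAINDER `R2` CONSTRUCTED AND CLASSED**
# — an2 gen 19's `SpineRecursiveT2AllFinal.…_of_letters_final` VERBATIM (`R2` by `Nat.rec` from `cE₂ • RW + RB 0` along the displayed recursion; its `LocStencil₂` + row-parity-odd
# classes at every level by the D1 swarm's `SecondOrderClassLiteral.class_R2_all`) over MY `CombQuarticTableLawCanon.T2RecAt_bref_all_of_letters_canon` instead of the kernel END
# (road-P2 chair of row G-an2-4, unit `b2b-balaban-gan24-p2` gen 48, crux team (2))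

NOT IN PRINT; OUR BOOKKEEPING ([folklore] wiring BY NAME; twin of an2 gen 19's `…_of_letters_final` with the root call swapped and the kernel-only binders (hBt)∕(hmixt) dropped; 0 `def`,
0 cited facts, 0 `def … : Prop`, 0 sorry).  HONEST FRAMING (cell contract, verbatim): «discharging `BetaPertH` makes Bałaban's UV stability UNCONDITIONAL — a real constructive-QFT
result; it is NOT the continuum limit and NOT the Clay problem.»  HONEST DEPENDENCY (verbatim): «continuum YM on T⁴ ⇐ BetaPertH ∧ nine spine estimates (0/9 proved); BetaPertH ⇐
(D1) ∧ (D4) ∧ CAP+tail; G-an2-4 gates asym, D1 and NE2/3/4.»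

WHAT.  **`T2RecAt_bref_all_of_letters_final`**: `∃ R2, (∀ j α, LocStencil₂ (R2 j α)) ∧ (∀ j α, row-parity-odd (R2 j α)) ∧ ∀ j α κ u κ′ u′, T2RecAt … j κ (bref α κ u) κ′ (bref α κ′ u′) =
(ε_κ ε_κ′) • refK (Φ Lc α) (T2RecAt … j κ u κ′ u′ + conjW 𝕄_j (S_j κ u) (S_j κ′ u′) (diagK (γ_j·ctGen α κ u)) (diagK (γ_j·ctGen α κ′ u′)) (diagK (γ_j²·ctGen α κ u·ctGen α κ′ u′)) +
R2 j α κ u κ′ u′)` — EXACTLY the shape (`hlaw`, `hR2c`, `hR2p`) MY `CombChargeParityOddOfQuarticLaw.zmode_T2RecAt_add_legSwap_eq_zero_of_law` consumes — from (hWff) the Wilson (2,2)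
reflection law at level `0` [an3's row], (hBfm∕hBmf∕hBmm) the border letter at every level [an1's], (hM2) the mixed letter [an1's], the residual classes, (hlock2) and the border
table's data (hB∕hB0).  EVERY LETTER IS A HYPOTHESIS; the remaining twins (`…AntiTwin`, `…Wilson`, `…Sockets`, `…LetterLevels`, `…TableLawEnd`, `…JsRowD1Pin`) discharge them at
the literal exactly as an2's kernel ENDs do.  Discharges NOTHING of (C)_{≥1} ∕ (Q-L) ∕ (H1♮); (β) of record untouched; NEVER «G-an2-4 closed» as (CONV-C); NOT D1, NOT
`BetaPertH`, NOT continuum, NOT Clay.  2026-08-23; no existing file touched.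
-/

noncomputable section

open Finset
open scoped BigOperators
open Literature.MathematicalPhysics.QuantumFieldTheory
open Literature.MathematicalPhysics.QuantumFieldTheory.Balaban1983to89
open Literature.MathematicalPhysics.QuantumFieldTheory.Balaban1983to89.Beta
open ExpKernelCalculus (MKer Decays BiLoc comp tadpole VertexFamily VertexFamily₂ shiftK)
open AffineAveraging (box toSite)
open AveragingContoursRooted (ctr ctrOff ctrOff_mem_box)
open PolarizationSign (reflSign AxisReflectionCovariant)
open KernelReflection (refK refK_apply)
open ResolventReflection (bref Φ)
open OneStepResolventKernel (Fib LocStencil JetData wsum)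
open OneStepKernelFamily (KInvStep colH vertexOfK TbalOf flipK)
open StepJetData (wilsonA)
open WilsonBiStencil (wilsonW₂)
open BalabanStepJetsSucc (wE wVH mmRead)
open BalabanCompositeJets (LocStencil₂)
open BalabanStepW2 (M2Of wV4 wB2 locStencil₂_smul' locStencil₂_add')
open SecondOrderResponse (dM W2OfK W2SymOfK LocStencilFM vertex2OfK mixOfK K2OfK)
open Summit.QuantumFields.BalabanUV.Beta.ChartConjugation (conjV conjW)
open Summit.QuantumFields.BalabanUV.Beta.AxialDressingRooted (coDressKBmAt)
open Summit.QuantumFields.BalabanUV.Beta.BorderedHessian (diagK ctGen bhKStepAt stepScale sgnK)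
open Summit.QuantumFields.BalabanUV.Beta.WardLocusCubic (mmSym)
open Summit.QuantumFields.BalabanUV.Beta.KernelWardRemainderParity (parityOdd_add)
open Summit.QuantumFields.BalabanUV.Beta.SpineRecursiveParity (parityOdd_smul)
open Summit.QuantumFields.BalabanUV.Beta.SecondOrderZeroCanon (locStencil₂_diagK_ctGen_mul_ctGen)
open Summit.QuantumFields.BalabanUV.Beta.SecondOrderClassLiteral (class_R2_all)

namespace Summit.QuantumFields.BalabanUV.Beta.GAN24.CombQuarticTableLawFinal

open Summit.QuantumFields.BalabanUV.Beta.TameKernelCalculus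
open Summit.QuantumFields.BalabanUV.Beta.SpineRooted
open Summit.QuantumFields.BalabanUV.Beta.GAN24.CombQuarticTableLawCanon (T2RecAt_bref_all_of_letters_canon)

variable {Lc : ℕ} [NeZero Lc]

/-- NOT IN PRINT; OUR BOOKKEEPING.  **THE QUARTIC TABLE LAW ⟸ THE THREE LETTERS + RESIDUAL CLASSES + LOCK + TABLE DATA, REMAINDER CONSTRUCTED AND CLASSED** (see the module
docstring). -/
theorem T2RecAt_bref_all_of_letters_final (hLc : Odd Lc) (cΛ cE₂ cB : ℝ) (T : Fin 4 → Fin 4 → Fin 4 → Fin 4 → ℝ)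
    {vh₂S : Fin 4 → (Fin 4 → ℤ) → Fin 4 → (Fin 4 → ℤ) → MKer 4 (Fib 3)} (hB : ∃ C δ : ℝ, 0 < δ ∧ LocStencil₂ vh₂S C δ)
    (hB0 : ∀ κ u κ' u' (x z : Fin 4 → ℤ) (β β' : Fin 4), vh₂S κ u κ' u' x z (Sum.inl β) (Sum.inl β') = 0)
    {mixFF : Fin 4 → (Fin 4 → ℤ) → Fin 4 → (Fin 4 → ℤ) → MKer 4 (Fib 3)} (hmix : ∃ C δ : ℝ, 0 < δ ∧ LocStencilFM Lc mixFF C δ)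
    (γ : ℕ → ℝ) (hγ : ∀ j, γ j = -((Lc : ℝ) ^ 8 / 2) * wVH 3 Lc j / (stepScale 3 Lc j * (Lc : ℝ) ^ 4))
    (hlock2 : ∀ j, cE₂ * wV4 3 Lc (j + 1) * wVH 3 Lc (j + 1) = ((Lc : ℝ) ^ 4 * wE 3 Lc (j + 1)) ^ 2)
    (RM : ℕ → Fin 4 → Fin 4 → (Fin 4 → ℤ) → Fin 4 → (Fin 4 → ℤ) → MKer 4 (Fib 3))
    (RW : Fin 4 → Fin 4 → (Fin 4 → ℤ) → Fin 4 → (Fin 4 → ℤ) → MKer 4 (Fib 3))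
    (RB : ℕ → Fin 4 → Fin 4 → (Fin 4 → ℤ) → Fin 4 → (Fin 4 → ℤ) → MKer 4 (Fib 3))
    -- (hWff) THE WILSON (2,2) LETTER AT LEVEL 0, PARAMETER-FREE UP TO AN ODD FIELD-SUPPORTED SLOT `RW`
    (hWff : ∀ (α κ : Fin 4) (u : Fin 4 → ℤ) (κ' : Fin 4) (u' : Fin 4 → ℤ) (x z : Fin 4 → ℤ) (β β' : Fin 4),
      wilsonW₂ 3 T κ (bref α κ u) κ' (bref α κ' u') x z (Sum.inl β) (Sum.inl β') =
        ((reflSign α κ * reflSign α κ') • refK (Φ Lc α)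
          (wilsonW₂ 3 T κ u κ' u' +
            conjW (bhKStepAt 3 (toSite (ctrOff 4 Lc)) Lc 0) (wilsonA 3 κ u) (wilsonA 3 κ' u')
              (diagK fun p c => (-(1 / 2 : ℝ)) * ctGen 3 α Lc κ u p c) (diagK fun p c => (-(1 / 2 : ℝ)) * ctGen 3 α Lc κ' u' p c)
              (diagK fun p c => (-(1 / 2 : ℝ)) ^ 2 * (ctGen 3 α Lc κ u p c * ctGen 3 α Lc κ' u' p c)) + RW α κ u κ' u')) x z (Sum.inl β) (Sum.inl β'))
    (hRWl : ∀ α κ u κ' u' (x z : Fin 4 → ℤ) (m : Fin 4) (b' : Fib 3), RW α κ u κ' u' x z (Sum.inr m) b' = 0)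
    (hRWr : ∀ α κ u κ' u' (x z : Fin 4 → ℤ) (a' : Fib 3) (m : Fin 4), RW α κ u κ' u' x z a' (Sum.inr m) = 0)
    (hRWc : ∀ α : Fin 4, ∃ C δ : ℝ, 0 < δ ∧ LocStencil₂ (RW α) C δ)
    (hRWp : ∀ (α : Fin 4) κ u κ' u', trK (RW α κ u κ' u') = -sgnK (RW α κ u κ' u'))
    -- (hM2) THE MIXED LETTER ∀ j
    (hM2 : ∀ (j : ℕ) (α κ : Fin 4) (u : Fin 4 → ℤ) (ρ : Fin 4) (w : Fin 4 → ℤ),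
      M2Of 3 Lc mixFF j κ (bref α κ u) ρ (bref α ρ w) =
        (reflSign α κ * reflSign α ρ) • refK (Φ Lc α)
          (M2Of 3 Lc mixFF j κ u ρ w + conjV (M1At 3 Lc (toSite (ctrOff 4 Lc)) cΛ j ρ w) (diagK fun p c => γ j * ctGen 3 α Lc κ u p c) +
            RM j α κ u ρ w))
    (hRMc : ∀ (j : ℕ) (α : Fin 4), ∃ C δ : ℝ, 0 < δ ∧ LocStencilFM Lc (RM j α) C δ)
    (hRMp : ∀ (j : ℕ) (α : Fin 4) κ u ρ w, trK (RM j α κ u ρ w) = -sgnK (RM j α κ u ρ w))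
    -- (hB*) THE BORDER LETTER AT EVERY LEVEL j ≥ 0, CANONICAL SECOND SYMBOL
    (hRBff : ∀ j α κ u κ' u' (x z : Fin 4 → ℤ) (β β' : Fin 4), RB j α κ u κ' u' x z (Sum.inl β) (Sum.inl β') = 0)
    (hRBc : ∀ (j : ℕ) (α : Fin 4), ∃ C δ : ℝ, 0 < δ ∧ LocStencil₂ (RB j α) C δ)
    (hRBp : ∀ (j : ℕ) (α : Fin 4) κ u κ' u', trK (RB j α κ u κ' u') = -sgnK (RB j α κ u κ' u'))
    (hBfm : ∀ (j : ℕ) (α : Fin 4) κ u κ' u' (x z : Fin 4 → ℤ) (β m : Fin 4),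
      ((cB * wB2 3 Lc j) • vh₂S κ (bref α κ u) κ' (bref α κ' u')) x z (Sum.inl β) (Sum.inr m) =
        ((reflSign α κ * reflSign α κ') • refK (Φ Lc α) ((cB * wB2 3 Lc j) • vh₂S κ u κ' u' +
          conjW (bhKStepAt 3 (toSite (ctrOff 4 Lc)) Lc j)
            (SpureRecAt 3 Lc (toSite (ctrOff 4 Lc)) ((Lc : ℝ) ^ 4) (-((Lc : ℝ) ^ 8 / 2)) cΛ j κ u)
            (SpureRecAt 3 Lc (toSite (ctrOff 4 Lc)) ((Lc : ℝ) ^ 4) (-((Lc : ℝ) ^ 8 / 2)) cΛ j κ' u')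
            (diagK fun p c => γ j * ctGen 3 α Lc κ u p c) (diagK fun p c => γ j * ctGen 3 α Lc κ' u' p c)
            (diagK fun p c => γ j ^ 2 * (ctGen 3 α Lc κ u p c * ctGen 3 α Lc κ' u' p c)) +
          RB j α κ u κ' u')) x z (Sum.inl β) (Sum.inr m))
    (hBmf : ∀ (j : ℕ) (α : Fin 4) κ u κ' u' (x z : Fin 4 → ℤ) (m β : Fin 4),
      ((cB * wB2 3 Lc j) • vh₂S κ (bref α κ u) κ' (bref α κ' u')) x z (Sum.inr m) (Sum.inl β) =
        ((reflSign α κ * reflSign α κ') • refK (Φ Lc α) ((cB * wB2 3 Lc j) • vh₂S κ u κ' u' +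
          conjW (bhKStepAt 3 (toSite (ctrOff 4 Lc)) Lc j)
            (SpureRecAt 3 Lc (toSite (ctrOff 4 Lc)) ((Lc : ℝ) ^ 4) (-((Lc : ℝ) ^ 8 / 2)) cΛ j κ u)
            (SpureRecAt 3 Lc (toSite (ctrOff 4 Lc)) ((Lc : ℝ) ^ 4) (-((Lc : ℝ) ^ 8 / 2)) cΛ j κ' u')
            (diagK fun p c => γ j * ctGen 3 α Lc κ u p c) (diagK fun p c => γ j * ctGen 3 α Lc κ' u' p c)
            (diagK fun p c => γ j ^ 2 * (ctGen 3 α Lc κ u p c * ctGen 3 α Lc κ' u' p c)) +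
          RB j α κ u κ' u')) x z (Sum.inr m) (Sum.inl β))
    (hBmm : ∀ (j : ℕ) (α : Fin 4) κ u κ' u' (x z : Fin 4 → ℤ) (m m' : Fin 4),
      ((cB * wB2 3 Lc j) • vh₂S κ (bref α κ u) κ' (bref α κ' u')) x z (Sum.inr m) (Sum.inr m') =
        ((reflSign α κ * reflSign α κ') • refK (Φ Lc α) ((cB * wB2 3 Lc j) • vh₂S κ u κ' u' +
          conjW (bhKStepAt 3 (toSite (ctrOff 4 Lc)) Lc j)
            (SpureRecAt 3 Lc (toSite (ctrOff 4 Lc)) ((Lc : ℝ) ^ 4) (-((Lc : ℝ) ^ 8 / 2)) cΛ j κ u)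
            (SpureRecAt 3 Lc (toSite (ctrOff 4 Lc)) ((Lc : ℝ) ^ 4) (-((Lc : ℝ) ^ 8 / 2)) cΛ j κ' u')
            (diagK fun p c => γ j * ctGen 3 α Lc κ u p c) (diagK fun p c => γ j * ctGen 3 α Lc κ' u' p c)
            (diagK fun p c => γ j ^ 2 * (ctGen 3 α Lc κ u p c * ctGen 3 α Lc κ' u' p c)) +
          RB j α κ u κ' u')) x z (Sum.inr m) (Sum.inr m'))
    :
    ∃ R2 : ℕ → Fin 4 → Fin 4 → (Fin 4 → ℤ) → Fin 4 → (Fin 4 → ℤ) → MKer 4 (Fib 3),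
      (∀ (j : ℕ) (α : Fin 4), ∃ C δ : ℝ, 0 < δ ∧ LocStencil₂ (R2 j α) C δ) ∧
      (∀ (j : ℕ) (α : Fin 4) κ u κ' u', trK (R2 j α κ u κ' u') = -sgnK (R2 j α κ u κ' u')) ∧
      ∀ (j : ℕ) (α κ : Fin 4) (u : Fin 4 → ℤ) (κ' : Fin 4) (u' : Fin 4 → ℤ),
        T2RecAt 3 Lc (toSite (ctrOff 4 Lc)) ((Lc : ℝ) ^ 4) (-((Lc : ℝ) ^ 8 / 2)) cΛ cE₂ cB T vh₂S mixFF j κ (bref α κ u) κ' (bref α κ' u') =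
          (reflSign α κ * reflSign α κ') • refK (Φ Lc α)
            (T2RecAt 3 Lc (toSite (ctrOff 4 Lc)) ((Lc : ℝ) ^ 4) (-((Lc : ℝ) ^ 8 / 2)) cΛ cE₂ cB T vh₂S mixFF j κ u κ' u' +
              conjW (bhKStepAt 3 (toSite (ctrOff 4 Lc)) Lc j)
                (SpureRecAt 3 Lc (toSite (ctrOff 4 Lc)) ((Lc : ℝ) ^ 4) (-((Lc : ℝ) ^ 8 / 2)) cΛ j κ u)
                (SpureRecAt 3 Lc (toSite (ctrOff 4 Lc)) ((Lc : ℝ) ^ 4) (-((Lc : ℝ) ^ 8 / 2)) cΛ j κ' u')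
                (diagK fun p c => γ j * ctGen 3 α Lc κ u p c) (diagK fun p c => γ j * ctGen 3 α Lc κ' u' p c) (diagK fun p c => γ j ^ 2 * (ctGen 3 α Lc κ u p c * ctGen 3 α Lc κ' u' p c)) +
              R2 j α κ u κ' u') := by
  have hL1 : 1 ≤ Lc := hLc.pos
  have hr := ctrOff_mem_box (d := 4) hL1
  -- THE REMAINDER FAMILY, CONSTRUCTED BY RECURSION ON THE LEVEL (level 0 := `cE₂ • RW + RB 0`; step := the displayed right-hand side of
  -- `hR2succ` with the displayed `X2s`/`Δ` and the canonical second symbol), packaged with its two defining equations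
  have key : ∀ (z : Fin 4 → Fin 4 → (Fin 4 → ℤ) → Fin 4 → (Fin 4 → ℤ) → MKer 4 (Fib 3)) (s : ℕ → (Fin 4 → Fin 4 → (Fin 4 → ℤ) → Fin 4 → (Fin 4 → ℤ) → MKer 4 (Fib
              3)) → Fin 4 → Fin 4 → (Fin 4 → ℤ) → Fin 4 → (Fin 4 → ℤ) → MKer 4 (Fib 3)),
      ∃ R2 : ℕ → Fin 4 → Fin 4 → (Fin 4 → ℤ) → Fin 4 → (Fin 4 → ℤ) → MKer 4 (Fib 3), R2 0 = z ∧ ∀ j : ℕ, R2 (j + 1) = s j (R2 j) :=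
    fun z s => ⟨Nat.rec (motive := fun _ => Fin 4 → Fin 4 → (Fin 4 → ℤ) → Fin 4 → (Fin 4 → ℤ) → MKer 4 (Fib 3)) z s, Nat.rec_zero z s, fun j => Nat.rec_add_one z s j⟩
  obtain ⟨R2, hR20F, hR2succF⟩ := key (fun α κ u κ' u' => cE₂ • RW α κ u κ' u' + RB 0 α κ u κ' u')
    (fun j prev α κ u κ' u' =>
      -((cE₂ * wV4 3 Lc (j + 1)) • mmRead Lc (comp (comp (coDressKBmAt (toSite (ctrOff 4 Lc)) Lc (KInvStep (d := 3) Lc j)) ((1 / 2 : ℝ) • conjV (bhKStepAt 3 (toSite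
              (ctrOff 4 Lc)) Lc j) (diagK fun p a => ((∑ κ₁, ∑' u₁, colH (coDressKBmAt (toSite (ctrOff 4 Lc)) Lc (KInvStep (d := 3) Lc j)) Lc κ' u' κ₁ u₁ * ∑ κ₂, ∑'
              u₂, colH (coDressKBmAt (toSite (ctrOff 4 Lc)) Lc (KInvStep (d := 3) Lc j)) Lc κ u κ₂ u₂ * (γ j ^ 2 * (ctGen 3 α Lc κ₁ u₁ p a * ctGen 3 α Lc κ₂ u₂ p a)))
            + ∑ κ₁, ∑' u₁, colH (K2OfK (coDressKBmAt (toSite (ctrOff 4 Lc)) Lc (KInvStep (d := 3) Lc j)) Lc (SpureRecAt 3 Lc (toSite (ctrOff 4 Lc)) ((Lc : ℝ) ^ 4)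
                (-((Lc : ℝ) ^ 8 / 2)) cΛ j) (M1At 3 Lc (toSite (ctrOff 4 Lc)) cΛ j) κ u + (-(comp (comp (coDressKBmAt (toSite (ctrOff 4 Lc)) Lc (KInvStep (d := 3) Lc j))
            (conjV (bhKStepAt 3 (toSite (ctrOff 4 Lc)) Lc j) (diagK fun p c => ∑ κ₃, ∑' u₃, colH (coDressKBmAt (toSite (ctrOff 4 Lc)) Lc (KInvStep (d := 3) Lc j))
                Lc κ u κ₃ u₃ * (γ j * ctGen 3 α Lc κ₃ u₃ p c)))) (coDressKBmAt (toSite (ctrOff 4 Lc)) Lc (KInvStep (d := 3) Lc j))))) Lc κ' u' κ₁ u₁ * (γ j * ctGen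
                3 α Lc κ₁ u₁ p a))
            - ((∑ κ₁, ∑' u₁, colH (coDressKBmAt (toSite (ctrOff 4 Lc)) Lc (KInvStep (d := 3) Lc j)) Lc κ u κ₁ u₁ * ∑ κ₂, ∑' u₂, colH (coDressKBmAt (toSite (ctrOff 4
                Lc)) Lc (KInvStep (d := 3) Lc j)) Lc κ' u' κ₂ u₂ * (γ j ^ 2 * (ctGen 3 α Lc κ₁ u₁ p a * ctGen 3 α Lc κ₂ u₂ p a)))
            + ∑ κ₁, ∑' u₁, colH (K2OfK (coDressKBmAt (toSite (ctrOff 4 Lc)) Lc (KInvStep (d := 3) Lc j)) Lc (SpureRecAt 3 Lc (toSite (ctrOff 4 Lc)) ((Lc : ℝ) ^ 4)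
                (-((Lc : ℝ) ^ 8 / 2)) cΛ j) (M1At 3 Lc (toSite (ctrOff 4 Lc)) cΛ j) κ' u' + (-(comp (comp (coDressKBmAt (toSite (ctrOff 4 Lc)) Lc (KInvStep (d := 3)
                Lc j))
            (conjV (bhKStepAt 3 (toSite (ctrOff 4 Lc)) Lc j) (diagK fun p c => ∑ κ₃, ∑' u₃, colH (coDressKBmAt (toSite (ctrOff 4 Lc)) Lc (KInvStep (d := 3) Lc j))
                Lc κ' u' κ₃ u₃ * (γ j * ctGen 3 α Lc κ₃ u₃ p c)))) (coDressKBmAt (toSite (ctrOff 4 Lc)) Lc (KInvStep (d := 3) Lc j))))) Lc κ u κ₁ u₁ * (γ j * ctGen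
                3 α Lc κ₁ u₁ p a)))
            + (1 / 2 : ℝ) • ((dM (-(comp (comp (coDressKBmAt (toSite (ctrOff 4 Lc)) Lc (KInvStep (d := 3) Lc j))
            (conjV (bhKStepAt 3 (toSite (ctrOff 4 Lc)) Lc j) (diagK fun p c => ∑ κ₃, ∑' u₃, colH (coDressKBmAt (toSite (ctrOff 4 Lc)) Lc (KInvStep (d := 3) Lc j))
                Lc κ' u' κ₃ u₃ * (γ j * ctGen 3 α Lc κ₃ u₃ p c)))) (coDressKBmAt (toSite (ctrOff 4 Lc)) Lc (KInvStep (d := 3) Lc j)))) Lc (SpureRecAt 3 Lc (toSite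
                (ctrOff 4 Lc)) ((Lc : ℝ) ^ 4) (-((Lc : ℝ) ^ 8 / 2)) cΛ j) (M1At 3 Lc (toSite (ctrOff 4 Lc)) cΛ j) κ u
            + (vertex2OfK (coDressKBmAt (toSite (ctrOff 4 Lc)) Lc (KInvStep (d := 3) Lc j)) Lc (prev α) κ u κ' u'
            + (mixOfK (coDressKBmAt (toSite (ctrOff 4 Lc)) Lc (KInvStep (d := 3) Lc j)) Lc (RM j α) κ u κ' u'
            + mixOfK (coDressKBmAt (toSite (ctrOff 4 Lc)) Lc (KInvStep (d := 3) Lc j)) Lc (RM j α) κ' u' κ u)))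
            + (dM (-(comp (comp (coDressKBmAt (toSite (ctrOff 4 Lc)) Lc (KInvStep (d := 3) Lc j))
            (conjV (bhKStepAt 3 (toSite (ctrOff 4 Lc)) Lc j) (diagK fun p c => ∑ κ₃, ∑' u₃, colH (coDressKBmAt (toSite (ctrOff 4 Lc)) Lc (KInvStep (d := 3) Lc j))
                Lc κ u κ₃ u₃ * (γ j * ctGen 3 α Lc κ₃ u₃ p c)))) (coDressKBmAt (toSite (ctrOff 4 Lc)) Lc (KInvStep (d := 3) Lc j)))) Lc (SpureRecAt 3 Lc (toSite
                (ctrOff 4 Lc)) ((Lc : ℝ) ^ 4) (-((Lc : ℝ) ^ 8 / 2)) cΛ j) (M1At 3 Lc (toSite (ctrOff 4 Lc)) cΛ j) κ' u'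
            + (vertex2OfK (coDressKBmAt (toSite (ctrOff 4 Lc)) Lc (KInvStep (d := 3) Lc j)) Lc (prev α) κ' u' κ u
            + (mixOfK (coDressKBmAt (toSite (ctrOff 4 Lc)) Lc (KInvStep (d := 3) Lc j)) Lc (RM j α) κ' u' κ u
            + mixOfK (coDressKBmAt (toSite (ctrOff 4 Lc)) Lc (KInvStep (d := 3) Lc j)) Lc (RM j α) κ u κ' u')))))) (coDressKBmAt (toSite (ctrOff 4 Lc)) Lc (KInvStep
                (d := 3) Lc j))))
            + RB (j + 1) α κ u κ' u'
            + conjV (mmRead Lc (coDressKBmAt (toSite (ctrOff 4 Lc)) Lc (KInvStep (d := 3) Lc j))) (diagK fun p c => cE₂ * wV4 3 Lc (j + 1) * mmSym Lc (fun p c =>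
                ((∑ κ₁, ∑' u₁, colH (coDressKBmAt (toSite (ctrOff 4 Lc)) Lc (KInvStep (d := 3) Lc j)) Lc κ u κ₁ u₁ * ∑ κ₂, ∑' u₂, colH (coDressKBmAt (toSite (ctrOff
                4 Lc)) Lc (KInvStep (d := 3) Lc j)) Lc κ' u' κ₂ u₂ * (γ j ^ 2 * (ctGen 3 α Lc κ₁ u₁ p c * ctGen 3 α Lc κ₂ u₂ p c)))
            + ∑ κ₁, ∑' u₁, colH (K2OfK (coDressKBmAt (toSite (ctrOff 4 Lc)) Lc (KInvStep (d := 3) Lc j)) Lc (SpureRecAt 3 Lc (toSite (ctrOff 4 Lc)) ((Lc : ℝ) ^ 4)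
                (-((Lc : ℝ) ^ 8 / 2)) cΛ j) (M1At 3 Lc (toSite (ctrOff 4 Lc)) cΛ j) κ' u' + (-(comp (comp (coDressKBmAt (toSite (ctrOff 4 Lc)) Lc (KInvStep (d := 3)
                Lc j))
            (conjV (bhKStepAt 3 (toSite (ctrOff 4 Lc)) Lc j) (diagK fun p c => ∑ κ₃, ∑' u₃, colH (coDressKBmAt (toSite (ctrOff 4 Lc)) Lc (KInvStep (d := 3) Lc j))
                Lc κ' u' κ₃ u₃ * (γ j * ctGen 3 α Lc κ₃ u₃ p c)))) (coDressKBmAt (toSite (ctrOff 4 Lc)) Lc (KInvStep (d := 3) Lc j))))) Lc κ u κ₁ u₁ * (γ j * ctGen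
                3 α Lc κ₁ u₁ p c))) p c
            - wVH 3 Lc (j + 1) * (γ (j + 1) ^ 2 * (ctGen 3 α Lc κ u p c * ctGen 3 α Lc κ' u' p c))))
  have hR20 : ∀ (α κ : Fin 4) (u : Fin 4 → ℤ) (κ' : Fin 4) (u' : Fin 4 → ℤ), R2 0 α κ u κ' u' = cE₂ • RW α κ u κ' u' + RB 0 α κ u κ' u' :=
    fun α κ u κ' u' => by rw [hR20F]
  have hR2succ := fun (j : ℕ) (α κ : Fin 4) (u : Fin 4 → ℤ) (κ' : Fin 4) (u' : Fin 4 → ℤ) =>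
    congrFun (congrFun (congrFun (congrFun (congrFun (hR2succF j) α) κ) u) κ') u'
  have hR20' : ∀ α : Fin 4, R2 0 α = fun κ u κ' u' => cE₂ • RW α κ u κ' u' + RB 0 α κ u κ' u' := fun α => by rw [hR20F]
  -- the level-0 class
  have h0l : ∀ α : Fin 4, ∃ C δ : ℝ, 0 < δ ∧ LocStencil₂ (R2 0 α) C δ := by
    intro α
    obtain ⟨C₁, δ₁, hδ₁, h1⟩ := hRWc α
    obtain ⟨C₂, δ₂, hδ₂, h2⟩ := hRBc 0 α
    refine ⟨|cE₂| * C₁ + C₂, min δ₁ δ₂, lt_min hδ₁ hδ₂, ?_⟩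
    rw [hR20' α]
    exact locStencil₂_add' (locStencil₂_smul' cE₂ (h1.mono (min_le_left _ _))) (h2.mono (min_le_right _ _))
  have h0p : ∀ (α κ : Fin 4) (u : Fin 4 → ℤ) (κ' : Fin 4) (u' : Fin 4 → ℤ), trK (R2 0 α κ u κ' u') = -sgnK (R2 0 α κ u κ' u') := by
    intro α κ u κ' u'
    rw [hR20]
    exact parityOdd_add (parityOdd_smul cE₂ (hRWp α κ u κ' u')) (hRBp 0 α κ u κ' u')
  -- THE CLASS INDUCTION (leaf-05-g5's `class_R2_all`, canonical second symbol, the wall's coefficients)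
  have hcls := class_R2_all (d := 3) hL1 hr ((Lc : ℝ) ^ 4) (-((Lc : ℝ) ^ 8 / 2)) cΛ γ (fun j => cE₂ * wV4 3 Lc (j + 1)) (fun j => wVH 3 Lc (j + 1))
    (fun j α κ u κ' u' p c => γ j ^ 2 * (ctGen 3 α Lc κ u p c * ctGen 3 α Lc κ' u' p c))
    (fun j α => ⟨_, 1, one_pos, locStencil₂_diagK_ctGen_mul_ctGen α Lc (γ j ^ 2) zero_le_one⟩) RM RB R2 hRMc hRMp hRBc hRBp h0l h0p
    hR2succ
  refine ⟨R2, fun j α => (hcls j α).1, fun j α => (hcls j α).2, ?_⟩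
  exact T2RecAt_bref_all_of_letters_canon hLc cΛ cE₂ cB T hB hB0 hmix γ hγ hlock2 R2 RM RW RB hWff hRWl hRWr hRWc
    hM2 hRMc hRBff hRBc hBfm hBmf hBmm
    (fun j α μ y ν y' p c => ((∑ κ₁, ∑' u₁, colH (coDressKBmAt (toSite (ctrOff 4 Lc)) Lc (KInvStep (d := 3) Lc j)) Lc μ y κ₁ u₁ * ∑ κ₂, ∑' u₂, colH (coDressKBmAt
              (toSite (ctrOff 4 Lc)) Lc (KInvStep (d := 3) Lc j)) Lc ν y' κ₂ u₂ * (γ j ^ 2 * (ctGen 3 α Lc κ₁ u₁ p c * ctGen 3 α Lc κ₂ u₂ p c)))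
            + ∑ κ₁, ∑' u₁, colH (K2OfK (coDressKBmAt (toSite (ctrOff 4 Lc)) Lc (KInvStep (d := 3) Lc j)) Lc (SpureRecAt 3 Lc (toSite (ctrOff 4 Lc)) ((Lc : ℝ) ^ 4)
                (-((Lc : ℝ) ^ 8 / 2)) cΛ j) (M1At 3 Lc (toSite (ctrOff 4 Lc)) cΛ j) ν y' + (-(comp (comp (coDressKBmAt (toSite (ctrOff 4 Lc)) Lc (KInvStep (d := 3) Lc j))
            (conjV (bhKStepAt 3 (toSite (ctrOff 4 Lc)) Lc j) (diagK fun p c => ∑ κ₃, ∑' u₃, colH (coDressKBmAt (toSite (ctrOff 4 Lc)) Lc (KInvStep (d := 3) Lc j))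
                Lc ν y' κ₃ u₃ * (γ j * ctGen 3 α Lc κ₃ u₃ p c)))) (coDressKBmAt (toSite (ctrOff 4 Lc)) Lc (KInvStep (d := 3) Lc j))))) Lc μ y κ₁ u₁ * (γ j * ctGen 3
                α Lc κ₁ u₁ p c)))
    (fun j α μ y ν y' => (dM (-(comp (comp (coDressKBmAt (toSite (ctrOff 4 Lc)) Lc (KInvStep (d := 3) Lc j))
            (conjV (bhKStepAt 3 (toSite (ctrOff 4 Lc)) Lc j) (diagK fun p c => ∑ κ₃, ∑' u₃, colH (coDressKBmAt (toSite (ctrOff 4 Lc)) Lc (KInvStep (d := 3) Lc j))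
                Lc ν y' κ₃ u₃ * (γ j * ctGen 3 α Lc κ₃ u₃ p c)))) (coDressKBmAt (toSite (ctrOff 4 Lc)) Lc (KInvStep (d := 3) Lc j)))) Lc (SpureRecAt 3 Lc (toSite
                (ctrOff 4 Lc)) ((Lc : ℝ) ^ 4) (-((Lc : ℝ) ^ 8 / 2)) cΛ j) (M1At 3 Lc (toSite (ctrOff 4 Lc)) cΛ j) μ y
            + (vertex2OfK (coDressKBmAt (toSite (ctrOff 4 Lc)) Lc (KInvStep (d := 3) Lc j)) Lc (R2 j α) μ y ν y'
            + (mixOfK (coDressKBmAt (toSite (ctrOff 4 Lc)) Lc (KInvStep (d := 3) Lc j)) Lc (RM j α) μ y ν y'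
            + mixOfK (coDressKBmAt (toSite (ctrOff 4 Lc)) Lc (KInvStep (d := 3) Lc j)) Lc (RM j α) ν y' μ y))))
    rfl rfl hR20 hR2succ (fun j α => (hcls (j + 1) α).1)

end Summit.QuantumFields.BalabanUV.Beta.GAN24.CombQuarticTableLawFinal

end

/-!
# `BalabanUV.Beta.GAN24.CombQuarticTableLawAntiTwin` — binder row G-an2-4 ∕ (CONV-C), W-slot, row (C) at levels ≥ 1, WANTED W-an2-1 (the quartic TABLE-level reflection law of the comb tower
# at the literal), FOURTH TWIN OF an2's END CHAIN: **THE QUARTIC TABLE LAW WITH THE BORDER SOCKET IN ITS SATISFIABLE (ANTI-TWIN, RESIDUAL-FREE) FORM** — an2 gen 19's `SpineRecursiveT2AllAntiTwin.…_of_letters_antiTwin` VERBATIM (the `fm` law exact, `mf` from the anti-twin parities by `SecondOrderBorderNoModel.conjW_canon_antiTwin`, `mm` zero on both sides, `RB := 0`) over MY `CombQuarticTableLawFinal.T2RecAt_bref_all_of_letters_final` instead of the kernel END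
# (road-P2 chair of row G-an2-4, unit `b2b-balaban-gan24-p2` gen 48, crux team (2))

NOT IN PRINT; OUR BOOKKEEPING ([folklore] wiring BY NAME; twin of an2's END with the root call swapped and the kernel-only binders dropped; 0 `def`, 0 cited facts, 0 `def … : Prop`,
0 sorry).  HONEST FRAMING (cell contract, verbatim): «discharging `BetaPertH` makes Bałaban's UV stability UNCONDITIONAL — a real constructive-QFT result; it is NOT the continuum
limit and NOT the Clay problem.»  HONEST DEPENDENCY (verbatim): «continuum YM on T⁴ ⇐ BetaPertH ∧ nine spine estimates (0/9 proved); BetaPertH ⇐ (D1) ∧ (D4) ∧ CAP+tail; G-an2-4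
gates asym, D1 and NE2/3/4.»

WHAT.  **`T2RecAt_bref_all_of_letters_antiTwin`**: the `∃ R2`-form quartic table law (classes ∧ row-parity ∧ law, canonical second symbol) from (hWff)+`RW`-classes, (hM2)+`RM`-classes, (hBat)∕(hBmm0)∕(hBe) the anti-twin border table with its ONE exact `fm` letter at every level, (hlock2), (hB)(hB0).
EVERY LETTER NOT YET DISCHARGED IS A HYPOTHESIS; discharges NOTHING of (C)_{≥1} ∕ (Q-L) ∕ (H1♮); (β) of record untouched; NEVER «G-an2-4 closed» as (CONV-C); NOT D1, NOT
`BetaPertH`, NOT continuum, NOT Clay.  2026-08-23; no existing file touched.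
-/

noncomputable section

open Finset
open scoped BigOperators
open Literature.MathematicalPhysics.QuantumFieldTheory
open Literature.MathematicalPhysics.QuantumFieldTheory.Balaban1983to89
open Literature.MathematicalPhysics.QuantumFieldTheory.Balaban1983to89.Beta
open ExpKernelCalculus (MKer Decays BiLoc comp tadpole VertexFamily VertexFamily₂ shiftK)
open AffineAveraging (box toSite)
open AveragingContoursRooted (ctr ctrOff ctrOff_mem_box)
open AveragingHessianKernels (packVH_inr_inr)
open AveragingHessianKernelsRooted (vhSAt)
open PolarizationSign (reflSign AxisReflectionCovariant)
open KernelReflection (refK refK_apply)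
open ResolventReflection (bref Φ)
open OneStepResolventKernel (Fib LocStencil JetData wsum)
open OneStepKernelFamily (KInvStep colH vertexOfK TbalOf flipK)
open StepJetData (wilsonA)
open WilsonBiStencil (wilsonW₂)
open HessKerRate (biLoc_zero)
open BalabanStepJetsSucc (wE wVH mmRead)
open BalabanCompositeJets (LocStencil₂)
open BalabanStepW2 (M2Of wV4 wB2)
open SecondOrderResponse (dM W2OfK W2SymOfK LocStencilFM vertex2OfK mixOfK K2OfK)
open Summit.QuantumFields.BalabanUV.Beta.ChartConjugation (conjV conjW)
open Summit.QuantumFields.BalabanUV.Beta.AxialDressingRooted (coDressKBmAt)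
open Summit.QuantumFields.BalabanUV.Beta.BorderedHessian (diagK ctGen bhKStepAt bhKStepAt_zero bhKStepAt_succ_mm bhKAt_inr_inr stepScale sgnK)
open Summit.QuantumFields.BalabanUV.Beta.WardLocusCubic (mmSym)
open Summit.QuantumFields.BalabanUV.Beta.SpineRecursiveParity (parityOdd_zero)
open Summit.QuantumFields.BalabanUV.Beta.SpineRecursivePureParity (trK_SpureRecAt)
open Summit.QuantumFields.BalabanUV.Beta.BorderedHessianStepParity (trK_bhKStepAt)
open Summit.QuantumFields.BalabanUV.Beta.SecondOrderStepLaw (conjW_diag_apply)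
open Summit.QuantumFields.BalabanUV.Beta.SecondOrderBorderParity (twin_of_parityOdd)
open Summit.QuantumFields.BalabanUV.Beta.SecondOrderBorderNoModel (antiTwin_of_parityEven conjW_canon_antiTwin)
open Summit.QuantumFields.BalabanUV.Beta.WilsonReflectionContact (wilsonA_inr_inr)


namespace Summit.QuantumFields.BalabanUV.Beta.GAN24.CombQuarticTableLawAntiTwin

open Summit.QuantumFields.BalabanUV.Beta.TameKernelCalculus
open Summit.QuantumFields.BalabanUV.Beta.SpineRooted
open Summit.QuantumFields.BalabanUV.Beta.GAN24.CombQuarticTableLawFinal (T2RecAt_bref_all_of_letters_final)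

variable {Lc : ℕ} [NeZero Lc]

/-- NOT IN PRINT; OUR BOOKKEEPING (table-law twin of an2's `axisReflectionCovariant_flipK_TbalOf_JsRecWAtOf_of_letters_antiTwin`; see the module docstring). -/
theorem T2RecAt_bref_all_of_letters_antiTwin (hLc : Odd Lc) (cΛ cE₂ cB : ℝ) (T : Fin 4 → Fin 4 → Fin 4 → Fin 4 → ℝ)
    {vh₂S : Fin 4 → (Fin 4 → ℤ) → Fin 4 → (Fin 4 → ℤ) → MKer 4 (Fib 3)} (hB : ∃ C δ : ℝ, 0 < δ ∧ LocStencil₂ vh₂S C δ)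
    (hB0 : ∀ κ u κ' u' (x z : Fin 4 → ℤ) (β β' : Fin 4), vh₂S κ u κ' u' x z (Sum.inl β) (Sum.inl β') = 0)
    {mixFF : Fin 4 → (Fin 4 → ℤ) → Fin 4 → (Fin 4 → ℤ) → MKer 4 (Fib 3)} (hmix : ∃ C δ : ℝ, 0 < δ ∧ LocStencilFM Lc mixFF C δ)
    (γ : ℕ → ℝ) (hγ : ∀ j, γ j = -((Lc : ℝ) ^ 8 / 2) * wVH 3 Lc j / (stepScale 3 Lc j * (Lc : ℝ) ^ 4))
    (hlock2 : ∀ j, cE₂ * wV4 3 Lc (j + 1) * wVH 3 Lc (j + 1) = ((Lc : ℝ) ^ 4 * wE 3 Lc (j + 1)) ^ 2)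
    (RM : ℕ → Fin 4 → Fin 4 → (Fin 4 → ℤ) → Fin 4 → (Fin 4 → ℤ) → MKer 4 (Fib 3))
    (RW : Fin 4 → Fin 4 → (Fin 4 → ℤ) → Fin 4 → (Fin 4 → ℤ) → MKer 4 (Fib 3))
    -- (hWff) THE WILSON (2,2) LETTER AT LEVEL 0, PARAMETER-FREE UP TO AN ODD FIELD-SUPPORTED SLOT `RW`
    (hWff : ∀ (α κ : Fin 4) (u : Fin 4 → ℤ) (κ' : Fin 4) (u' : Fin 4 → ℤ) (x z : Fin 4 → ℤ) (β β' : Fin 4),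
      wilsonW₂ 3 T κ (bref α κ u) κ' (bref α κ' u') x z (Sum.inl β) (Sum.inl β') =
        ((reflSign α κ * reflSign α κ') • refK (Φ Lc α)
          (wilsonW₂ 3 T κ u κ' u' +
            conjW (bhKStepAt 3 (toSite (ctrOff 4 Lc)) Lc 0) (wilsonA 3 κ u) (wilsonA 3 κ' u')
              (diagK fun p c => (-(1 / 2 : ℝ)) * ctGen 3 α Lc κ u p c) (diagK fun p c => (-(1 / 2 : ℝ)) * ctGen 3 α Lc κ' u' p c)
              (diagK fun p c => (-(1 / 2 : ℝ)) ^ 2 * (ctGen 3 α Lc κ u p c * ctGen 3 α Lc κ' u' p c)) + RW α κ u κ' u')) x z (Sum.inl β) (Sum.inl β'))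
    (hRWl : ∀ α κ u κ' u' (x z : Fin 4 → ℤ) (m : Fin 4) (b' : Fib 3), RW α κ u κ' u' x z (Sum.inr m) b' = 0)
    (hRWr : ∀ α κ u κ' u' (x z : Fin 4 → ℤ) (a' : Fib 3) (m : Fin 4), RW α κ u κ' u' x z a' (Sum.inr m) = 0)
    (hRWc : ∀ α : Fin 4, ∃ C δ : ℝ, 0 < δ ∧ LocStencil₂ (RW α) C δ)
    (hRWp : ∀ (α : Fin 4) κ u κ' u', trK (RW α κ u κ' u') = -sgnK (RW α κ u κ' u'))
    -- (hM2) THE MIXED LETTER ∀ j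
    (hM2 : ∀ (j : ℕ) (α κ : Fin 4) (u : Fin 4 → ℤ) (ρ : Fin 4) (w : Fin 4 → ℤ),
      M2Of 3 Lc mixFF j κ (bref α κ u) ρ (bref α ρ w) =
        (reflSign α κ * reflSign α ρ) • refK (Φ Lc α)
          (M2Of 3 Lc mixFF j κ u ρ w + conjV (M1At 3 Lc (toSite (ctrOff 4 Lc)) cΛ j ρ w) (diagK fun p c => γ j * ctGen 3 α Lc κ u p c) +
            RM j α κ u ρ w))
    (hRMc : ∀ (j : ℕ) (α : Fin 4), ∃ C δ : ℝ, 0 < δ ∧ LocStencilFM Lc (RM j α) C δ)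
    (hRMp : ∀ (j : ℕ) (α : Fin 4) κ u ρ w, trK (RM j α κ u ρ w) = -sgnK (RM j α κ u ρ w))
    -- THE BORDER TABLE IS ANTI-TWIN (parity-even) WITH NO mm BLOCK, AND ITS LETTER IS ONE EXACT fm-LAW ∀ j ≥ 0 (X-an2-46)
    (hBat : ∀ κ u κ' u' (x z : Fin 4 → ℤ) (β m : Fin 4), vh₂S κ u κ' u' z x (Sum.inr m) (Sum.inl β) = -vh₂S κ u κ' u' x z (Sum.inl β) (Sum.inr m))
    (hBmm0 : ∀ κ u κ' u' (x z : Fin 4 → ℤ) (m m' : Fin 4), vh₂S κ u κ' u' x z (Sum.inr m) (Sum.inr m') = 0)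
    (hBe : ∀ (j : ℕ) (α : Fin 4) κ u κ' u' (x z : Fin 4 → ℤ) (β m : Fin 4),
      ((cB * wB2 3 Lc j) • vh₂S κ (bref α κ u) κ' (bref α κ' u')) x z (Sum.inl β) (Sum.inr m) =
        ((reflSign α κ * reflSign α κ') • refK (Φ Lc α) ((cB * wB2 3 Lc j) • vh₂S κ u κ' u' +
          conjW (bhKStepAt 3 (toSite (ctrOff 4 Lc)) Lc j)
            (SpureRecAt 3 Lc (toSite (ctrOff 4 Lc)) ((Lc : ℝ) ^ 4) (-((Lc : ℝ) ^ 8 / 2)) cΛ j κ u)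
            (SpureRecAt 3 Lc (toSite (ctrOff 4 Lc)) ((Lc : ℝ) ^ 4) (-((Lc : ℝ) ^ 8 / 2)) cΛ j κ' u')
            (diagK fun p c => γ j * ctGen 3 α Lc κ u p c) (diagK fun p c => γ j * ctGen 3 α Lc κ' u' p c)
            (diagK fun p c => γ j ^ 2 * (ctGen 3 α Lc κ u p c * ctGen 3 α Lc κ' u' p c)))) x z (Sum.inl β) (Sum.inr m))
    :
    ∃ R2 : ℕ → Fin 4 → Fin 4 → (Fin 4 → ℤ) → Fin 4 → (Fin 4 → ℤ) → ExpKernelCalculus.MKer 4 (OneStepResolventKernel.Fib 3),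
      (∀ (j : ℕ) (α : Fin 4), ∃ C δ : ℝ, 0 < δ ∧ BalabanCompositeJets.LocStencil₂ (R2 j α) C δ) ∧
      (∀ (j : ℕ) (α : Fin 4) κ u κ' u', TameKernelCalculus.trK (R2 j α κ u κ' u') = -BorderedHessian.sgnK (R2 j α κ u κ' u')) ∧
      ∀ (j : ℕ) (α κ : Fin 4) (u : Fin 4 → ℤ) (κ' : Fin 4) (u' : Fin 4 → ℤ),
        SpineRooted.T2RecAt 3 Lc (AffineAveraging.toSite (AveragingContoursRooted.ctrOff 4 Lc)) ((Lc : ℝ) ^ 4) (-((Lc : ℝ) ^ 8 / 2)) cΛ cE₂ cB T vh₂S mixFF j κ (ResolventReflection.bref α κ u) κ' (ResolventReflection.bref α κ' u') =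
          (PolarizationSign.reflSign α κ * PolarizationSign.reflSign α κ') • KernelReflection.refK (ResolventReflection.Φ Lc α)
            (SpineRooted.T2RecAt 3 Lc (AffineAveraging.toSite (AveragingContoursRooted.ctrOff 4 Lc)) ((Lc : ℝ) ^ 4) (-((Lc : ℝ) ^ 8 / 2)) cΛ cE₂ cB T vh₂S mixFF j κ u κ' u' +
              ChartConjugation.conjW (BorderedHessian.bhKStepAt 3 (AffineAveraging.toSite (AveragingContoursRooted.ctrOff 4 Lc)) Lc j)
                (SpineRooted.SpureRecAt 3 Lc (AffineAveraging.toSite (AveragingContoursRooted.ctrOff 4 Lc)) ((Lc : ℝ) ^ 4) (-((Lc : ℝ) ^ 8 / 2)) cΛ j κ u)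
                (SpineRooted.SpureRecAt 3 Lc (AffineAveraging.toSite (AveragingContoursRooted.ctrOff 4 Lc)) ((Lc : ℝ) ^ 4) (-((Lc : ℝ) ^ 8 / 2)) cΛ j κ' u')
                (BorderedHessian.diagK fun p c => γ j * BorderedHessian.ctGen 3 α Lc κ u p c) (BorderedHessian.diagK fun p c => γ j * BorderedHessian.ctGen 3 α Lc κ' u' p c) (BorderedHessian.diagK fun p c => γ j ^ 2 * (BorderedHessian.ctGen 3 α Lc κ u p c * BorderedHessian.ctGen 3 α Lc κ' u' p c)) +
              R2 j α κ u κ' u') := by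
  have hL1 : 1 ≤ Lc := hLc.pos
  have hr := ctrOff_mem_box (d := 4) hL1
  -- parities of the wall's letters on the border blocks
  have hSt : ∀ (j : ℕ) (κ : Fin 4) (u x z : Fin 4 → ℤ) (β m : Fin 4),
      SpureRecAt 3 Lc (toSite (ctrOff 4 Lc)) ((Lc : ℝ) ^ 4) (-((Lc : ℝ) ^ 8 / 2)) cΛ j κ u z x (Sum.inr m) (Sum.inl β) =
        SpureRecAt 3 Lc (toSite (ctrOff 4 Lc)) ((Lc : ℝ) ^ 4) (-((Lc : ℝ) ^ 8 / 2)) cΛ j κ u x z (Sum.inl β) (Sum.inr m) :=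
    fun j κ u x z β m => twin_of_parityOdd (trK_SpureRecAt hL1 hr _ _ _ j κ u) x z β m
  have hMa : ∀ (j : ℕ) (x z : Fin 4 → ℤ) (β m : Fin 4),
      bhKStepAt 3 (toSite (ctrOff 4 Lc)) Lc j z x (Sum.inr m) (Sum.inl β) = -bhKStepAt 3 (toSite (ctrOff 4 Lc)) Lc j x z (Sum.inl β) (Sum.inr m) :=
    fun j x z β m => antiTwin_of_parityEven (trK_bhKStepAt (toSite (ctrOff 4 Lc)) Lc j) x z β m
  refine T2RecAt_bref_all_of_letters_final hLc cΛ cE₂ cB T hB hB0 hmix γ hγ hlock2 RM RW (fun _ _ _ _ _ _ => 0) hWff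
    hRWl hRWr hRWc hRWp hM2 hRMc hRMp (fun _ _ _ _ _ _ _ _ _ _ => rfl)
    (fun _ _ => ⟨0, 1, one_pos, fun κ u κ' u' => by simpa using (biLoc_zero u u (1 : ℝ) : BiLoc (0 : MKer 4 (Fib 3)) u u 0 1)⟩)
    (fun _ _ _ _ _ _ => parityOdd_zero) ?_ ?_ ?_
  · -- fm: the exact law, `RB := 0`
    intro j α κ u κ' u' x z β m
    simpa only [add_zero] using hBe j α κ u κ' u' x z β m
  · -- mf: from the fm law at the transposed entry, by the anti-twin parities of BOTH sides
    intro j α κ u κ' u' x z m β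
    have e := hBe j α κ u κ' u' z x β m
    have aC := conjW_canon_antiTwin (𝕄 := bhKStepAt 3 (toSite (ctrOff 4 Lc)) Lc j)
      (S := SpureRecAt 3 Lc (toSite (ctrOff 4 Lc)) ((Lc : ℝ) ^ 4) (-((Lc : ℝ) ^ 8 / 2)) cΛ j κ u)
      (S' := SpureRecAt 3 Lc (toSite (ctrOff 4 Lc)) ((Lc : ℝ) ^ 4) (-((Lc : ℝ) ^ 8 / 2)) cΛ j κ' u')
      (g := fun p c => γ j * ctGen 3 α Lc κ u p c) (g' := fun p c => γ j * ctGen 3 α Lc κ' u' p c) (hSt j κ u) (hSt j κ' u') (hMa j)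
    have hcan : (diagK fun p c => γ j ^ 2 * (ctGen 3 α Lc κ u p c * ctGen 3 α Lc κ' u' p c)) =
        diagK fun p a => (γ j * ctGen 3 α Lc κ u p a) * (γ j * ctGen 3 α Lc κ' u' p a) := by
      congr 1; funext p a; ring
    rw [hcan] at e ⊢
    simp only [Pi.smul_apply, Pi.add_apply, add_zero, smul_eq_mul, refK_apply] at e ⊢
    rw [hBat κ (bref α κ u) κ' (bref α κ' u') z x β m, hBat κ u κ' u' _ _ β m, aC]
    linear_combination -e
  · -- mm: both sides vanish (no mm block in `vh₂S`, `SpureRecAt j`, `bhKStepAt j`)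
    intro j α κ u κ' u' x z m m'
    simp only [Pi.smul_apply, Pi.add_apply, smul_eq_mul, refK_apply, hBmm0, conjW_diag_apply, SpureRecAt_inr_inr,
      bhKStepAt_inr_inr, mul_zero, zero_mul, add_zero]

end Summit.QuantumFields.BalabanUV.Beta.GAN24.CombQuarticTableLawAntiTwin

end
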